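import Literature.MathematicalPhysics.QuantumFieldTheory.Balaban1983to89.T4Covariance

/-!
# Lane `pub-balaban3d` — carrier layer p1, part 7 (`Carriers.RadialContour`): the contour system `Γ_{y,x}` of
# [Balaban1984PropagatorsI] (1.7) p. 18 as a `Setup.ContourData` (ruling R-FOREST: ONE axial gauge for (9) and (10))

Source: T. Bałaban, CMP **95** (1984) 17–40 [Balaban1984PropagatorsI], (1.7) p. 18 (render `…/1984-cmp95-propagators-rt-I/…-p002-x2.png`):
«Γ_{y,x} = [y,(y₁,…,y_{d−1},x_d)] ∪ … ∪ [(y₁,…,y_μ,x_{μ+1},…,x_d),(y₁,…,x_μ,x_{μ+1},…,x_d)] ∪ … ∪ [(y₁,x₂,…,x_d), x]» — from `y` to `x`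
one moves first along the LAST coordinate, then the preceding ones; [Balaban1985Averaging] (9) p. 18 «U(Γ) = Π U(⟨x_i,x_{i+1}⟩), the
order of factors … the same as the order of bonds in Γ» and (7) «U(x,x′) = U^{−1}(x′,x)».  In the tree's CENTRED convention (cell
pub-balaban DIVERGENCE F3) `y` is the block centre `Setup.emb y`.

WHAT IS DEFINED/PROVED ([folklore]): `radialHol U y x = U(Γ_{y,x})`, the ordered product of the bond variables along the coordinate path
from `emb y` to `x` (coordinate `d−1` first, …, `0` last; along each coordinate the shorter way round the torus, which inside the block
`B(y)` is the geometric segment), for EVERY pair `(y, x)`; its GAUGE COVARIANCE `U^u(Γ_{y,x}) = u(y) U(Γ_{y,x}) u(x)^{−1}`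
([Balaban1985Averaging] (11)-type identity, by telescoping); hence **`radialContourData : Setup.ContourData P j G`** — the contour
datum over which the spine's `SectA.Eq9` (p4's `eq9_holds`) and, through the radial forest `Carriers.Formula10.radialBonds`, `SectA.Eq10`
(`Carriers.Eq10Run3.eq10_run3`) speak about ONE axial gauge.  The bond-set identification `⋃_{x∈B(y)} bonds(Γ_{y,x}) = radialBonds {y}`
is the follow-up lemma (booked in the seat's NOTES); nothing of CMP 102 is asserted.
-/

namespace Summit.QuantumFields.Balaban3D.Carriers

open Literature.MathematicalPhysics.QuantumFieldTheory.Balaban1983to89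

variable {P : Params} {j : ℕ} {G : Type*} [GaugeGroup G]

/-! ## §1 Transport along coordinate segments -/

/-- `n`-fold shift `z + n e_μ`. [folklore] -/
def shiftN (z : Site P j) (μ : Fin P.d) : ℕ → Site P j
  | 0 => z
  | n + 1 => shiftN (z.shift μ) μ n

/-- `n`-fold unshift `z − n e_μ`. [folklore] -/
def unshiftN (z : Site P j) (μ : Fin P.d) : ℕ → Site P j
  | 0 => z
  | n + 1 => unshiftN (z.unshift μ) μ n

/-- FORWARD transport `U(⟨z,z+e_μ⟩) U(⟨z+e_μ,z+2e_μ⟩) ⋯` over `n` bonds ([Balaban1985Averaging] (9): factors in path order). [cite: Balaban1985Averaging, (9) p.18] -/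
def fwdHol (U : GaugeField P j G) (μ : Fin P.d) : ℕ → Site P j → G
  | 0, _ => 1
  | n + 1, z => U ⟨z, μ⟩ * fwdHol U μ n (z.shift μ)

/-- BACKWARD transport `U(⟨z−e_μ,z⟩)^{−1} U(⟨z−2e_μ,z−e_μ⟩)^{−1} ⋯` over `n` bonds ((7): `U(x,x′) = U(x′,x)^{−1}`). [cite: Balaban1985Averaging, (7) p.18] -/
def bwdHol (U : GaugeField P j G) (μ : Fin P.d) : ℕ → Site P j → G
  | 0, _ => 1
  | n + 1, z => (U ⟨z.unshift μ, μ⟩)⁻¹ * bwdHol U μ n (z.unshift μ)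

/- `(z − e_μ) + e_μ = z` is LQB `Site.shift_unshift` (T4Covariance) — reused, not restated (gate dedup). -/

/-- Covariance of the forward transport: `(U^u)(segment) = u(start) U(segment) u(end)^{−1}`. [cite: Balaban1985Averaging, (11) p.19] -/
theorem fwdHol_gaugeAct (u : GaugeTransf P j G) (U : GaugeField P j G) (μ : Fin P.d) :
    ∀ (n : ℕ) (z : Site P j), fwdHol (GaugeField.gaugeAct u U) μ n z = u z * fwdHol U μ n z * (u (shiftN z μ n))⁻¹
  | 0, z => by simp [fwdHol, shiftN]
  | n + 1, z => by
    simp only [fwdHol, shiftN]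
    rw [fwdHol_gaugeAct u U μ n (z.shift μ)]
    simp only [GaugeField.gaugeAct, PBond.tgt]
    group

/-- Covariance of the backward transport. [cite: Balaban1985Averaging, (11) p.19] -/
theorem bwdHol_gaugeAct (u : GaugeTransf P j G) (U : GaugeField P j G) (μ : Fin P.d) :
    ∀ (n : ℕ) (z : Site P j), bwdHol (GaugeField.gaugeAct u U) μ n z = u z * bwdHol U μ n z * (u (unshiftN z μ n))⁻¹
  | 0, z => by simp [bwdHol, unshiftN]
  | n + 1, z => by
    simp only [bwdHol, unshiftN]
    rw [bwdHol_gaugeAct u U μ n (z.unshift μ)]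
    simp only [GaugeField.gaugeAct, PBond.tgt, Site.shift_unshift]
    group

/-- The endpoint of the forward segment: `(z + n e_μ)_μ = z_μ + n`, other coordinates unchanged. [folklore] -/
theorem shiftN_eq (z : Site P j) (μ : Fin P.d) : ∀ n : ℕ, shiftN z μ n = Function.update z μ (z μ + n)
  | 0 => by simp [shiftN]
  | n + 1 => by
    rw [shiftN, shiftN_eq (z.shift μ) μ n]
    funext ν
    by_cases h : ν = μ
    · subst h; simp [Site.shift]; ring
    · simp [Site.shift, Function.update_of_ne h]

/-- The endpoint of the backward segment: `(z − n e_μ)_μ = z_μ − n`. [folklore] -/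
theorem unshiftN_eq (z : Site P j) (μ : Fin P.d) : ∀ n : ℕ, unshiftN z μ n = Function.update z μ (z μ - n)
  | 0 => by simp [unshiftN]
  | n + 1 => by
    rw [unshiftN, unshiftN_eq (z.unshift μ) μ n]
    funext ν
    by_cases h : ν = μ
    · subst h; simp [Site.unshift]; ring
    · simp [Site.unshift, Function.update_of_ne h]

/-- TRANSPORT ALONG ONE COORDINATE from `z` to the point with `μ`-coordinate `b` (the shorter way round the torus; inside a block this is
the geometric segment of (1.7)). [cite: Balaban1984PropagatorsI, (1.7) p.18] -/
def moveHol (U : GaugeField P j G) (μ : Fin P.d) (b : ZMod (P.sitesPerDir j)) (z : Site P j) : G :=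
  if (b - z μ).val ≤ (z μ - b).val then fwdHol U μ (b - z μ).val z else bwdHol U μ (z μ - b).val z

/-- The coordinate move ends at `z` with its `μ`-coordinate replaced by `b`. [folklore] -/
theorem moveHol_gaugeAct (u : GaugeTransf P j G) (U : GaugeField P j G) (μ : Fin P.d) (b : ZMod (P.sitesPerDir j)) (z : Site P j) :
    moveHol (GaugeField.gaugeAct u U) μ b z = u z * moveHol U μ b z * (u (Function.update z μ b))⁻¹ := by
  unfold moveHol
  split_ifs with h
  · rw [fwdHol_gaugeAct, shiftN_eq]
    simp [ZMod.natCast_val, ZMod.cast_id', id]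
  · rw [bwdHol_gaugeAct, unshiftN_eq]
    simp [ZMod.natCast_val, ZMod.cast_id', id]

/-! ## §2 The contour `Γ_{y,x}` and its holonomy -/

/-- Transport along the coordinate path that sets the coordinates of the list `l` (in order) to those of `x`, starting at `z`. [folklore] -/
def pathHol (U : GaugeField P j G) (x : Site P j) : List (Fin P.d) → Site P j → G
  | [], _ => 1
  | μ :: l, z => moveHol U μ (x μ) z * pathHol U x l (Function.update z μ (x μ))

/-- Endpoint of the coordinate path. [folklore] -/
def pathEnd (x : Site P j) : List (Fin P.d) → Site P j → Site P j
  | [], z => z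
  | μ :: l, z => pathEnd x l (Function.update z μ (x μ))

/-- The path ends where every listed coordinate equals that of `x` and the others are unchanged. [folklore] -/
theorem pathEnd_apply (x : Site P j) : ∀ (l : List (Fin P.d)) (z : Site P j) (ν : Fin P.d),
    pathEnd x l z ν = if ν ∈ l then x ν else z ν
  | [], z, ν => by simp [pathEnd]
  | μ :: l, z, ν => by
    rw [pathEnd, pathEnd_apply x l _ ν]
    by_cases hν : ν ∈ l
    · simp [hν]
    · by_cases hμ : ν = μ
      · subst hμ; simp [hν]
      · simp [hν, hμ]

/-- Covariance of the path transport (telescoping). [cite: Balaban1985Averaging, (11) p.19] -/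
theorem pathHol_gaugeAct (u : GaugeTransf P j G) (U : GaugeField P j G) (x : Site P j) :
    ∀ (l : List (Fin P.d)) (z : Site P j),
      pathHol (GaugeField.gaugeAct u U) x l z = u z * pathHol U x l z * (u (pathEnd x l z))⁻¹
  | [], z => by simp [pathHol, pathEnd]
  | μ :: l, z => by
    simp only [pathHol, pathEnd]
    rw [moveHol_gaugeAct, pathHol_gaugeAct u U x l]
    group

variable (P) in
/-- The coordinate order of (1.7): the LAST coordinate first. [cite: Balaban1984PropagatorsI, (1.7) p.18] -/
def coordsDesc : List (Fin P.d) := (List.finRange P.d).reverse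

/-- **`U(Γ_{y,x})`**: the holonomy along the contour (1.7) from the block centre `emb y` to `x` (defined for every `x`; for `x ∈ B(y)`
it is print's `Γ_{y,x}`). [cite: Balaban1984PropagatorsI, (1.7) p.18] -/
def radialHol (U : GaugeField P j G) (y : Site P (j + 1)) (x : Site P j) : G := pathHol U x (coordsDesc P) (emb y)

/-- The contour `Γ_{y,x}` ends at `x`. [folklore] -/
theorem pathEnd_coordsDesc (x z : Site P j) : pathEnd x (coordsDesc P) z = x := by
  funext ν
  rw [pathEnd_apply]
  simp [coordsDesc]

/-- **GAUGE COVARIANCE** `U^u(Γ_{y,x}) = u(y) U(Γ_{y,x}) u(x)^{−1}` (with `y` read as the fine site `emb y`). [cite: Balaban1985Averaging, (11) p.19] -/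
theorem radialHol_gaugeAct (u : GaugeTransf P j G) (U : GaugeField P j G) (y : Site P (j + 1)) (x : Site P j) :
    radialHol (GaugeField.gaugeAct u U) y x = u (emb y) * radialHol U y x * (u x)⁻¹ := by
  unfold radialHol
  rw [pathHol_gaugeAct, pathEnd_coordsDesc]

/-- **THE CONTOUR SYSTEM OF (1.7) AS A `Setup.ContourData`** (ruling R-FOREST: the ONE axial gauge of (9) and (10)): `holTo U y x :=
U(Γ_{y,x})`, covariant. [cite: Balaban1984PropagatorsI, (1.7) p.18] -/
def radialContourData (P : Params) (j : ℕ) (G : Type*) [GaugeGroup G] : ContourData P j G where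
  holTo U y x := radialHol U y x
  covariant u U y x := radialHol_gaugeAct u U y x

/-- Unfolding lemma. [folklore] -/
theorem radialContourData_holTo (U : GaugeField P j G) (y : Site P (j + 1)) (x : Site P j) :
    (radialContourData P j G).holTo U y x = radialHol U y x := rfl

/-- The trivial configuration has trivial holonomies along every contour. [folklore] -/
theorem radialHol_one (y : Site P (j + 1)) (x : Site P j) : radialHol (1 : GaugeField P j G) y x = 1 := by
  have hf : ∀ (μ : Fin P.d) (n : ℕ) (z : Site P j), fwdHol (1 : GaugeField P j G) μ n z = 1 := by
    intro μ n; induction n with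
    | zero => intro z; rfl
    | succ n ih => intro z; simp [fwdHol, ih]; rfl
  have hb : ∀ (μ : Fin P.d) (n : ℕ) (z : Site P j), bwdHol (1 : GaugeField P j G) μ n z = 1 := by
    intro μ n; induction n with
    | zero => intro z; rfl
    | succ n ih =>
      intro z; simp only [bwdHol, ih, mul_one, inv_eq_one]; rfl
  have hm : ∀ (μ : Fin P.d) (b : ZMod (P.sitesPerDir j)) (z : Site P j), moveHol (1 : GaugeField P j G) μ b z = 1 := by
    intro μ b z; unfold moveHol; split_ifs <;> simp [hf, hb]
  have hp : ∀ (l : List (Fin P.d)) (z : Site P j), pathHol (1 : GaugeField P j G) x l z = 1 := by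
    intro l; induction l with
    | nil => intro z; rfl
    | cons μ l ih => intro z; simp [pathHol, hm, ih]
  exact hp _ _

end Summit.QuantumFields.Balaban3D.Carriers
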